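import Literature.MathematicalPhysics.QuantumFieldTheory.Balaban1983to89.HaarExpChartChangeOfVariables
import Mathlib.MeasureTheory.Integral.Marginal

/-!
# `Balaban1983to89.HaarExpChartChangeOfVariablesPi` — the PRODUCT (all-bonds) form ON AN INJECTIVITY WINDOW of Haar
# measure in exponential coordinates and of the change of variables under chart-`C¹` maps: [Balaban1985UV3] (18) p. 260
# «Π_b dU′(b) = e^{|Ω₁| log σ₀} Π_b (σ/σ₀)(A′(b)) dA′(b)» RESTRICTED to `(Θ Ω)^B` for an arbitrary Borel injectivity domain
# `Ω ⊆ 𝔤` (p28 gen 16 `HaarExponentialChartProduct` has the WHOLE-GROUP form under `μ((Θ Ω)ᶜ) = 0` only), composed with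
# Mathlib's `ℝⁿ` change of variables on the finite-dimensional space `B → 𝔤`

statement-level skeleton of published theorems with citation tags; proofs where landed; nothing here is a claim
about the Yang–Mills mass gap

Cell `pub-ymgap`, seat `pub-ymgap-dag-n09-w4` (gen 4; node N09, helper lane of the K1⁷ item, count-neutral).  WHY: the
Jacobian face (F1) of [Balaban1987RG1] (2.10) p. 267 is a change of variables for the PRODUCT Haar measure of the bond
variables `U ∈ G^B` (the tree's `fieldMeasure`) supported in a WINDOW `(Θ Ω)^B` around a configuration — never on a
full-measure chart domain.  File 1 (`HaarExpChartChangeOfVariables`) is the one-variable form; this is the `G^B` form.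

SETTING = file 1's (p28 `IsChartRep C ρ`, `hlie`, `η` additive Haar on `𝔤 = C.lie`, `μ` Haar on `G`, `0 < s ≤ s_C`,
`σ₀ = μ(V_s)/ν_s(V_s)`, `jacDensity = |det jac|`), a finite bond set `B`, `Θ^B A := (Θ A_b)_b`, `⊗μ := Measure.pi (fun _ => μ)`.

CONTENT (theorems only; 0 def, 0 instance, 0 sorry; axioms standard; three FILE-PRIVATE Fubini helpers re-proved because
p28 gen 16's are `private`).
* §1 **`pi_haar_restrict_eq_smul`** — `(⊗μ)|_{(ΘΩ)^B} = σ₀^{|B|} • (Θ^B)_*((Π_b |det jac A_b|) · (⊗η)|_{Ω^B})` for EVERY Borel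
  injectivity domain `Ω`; **`pi_haar_restrict_image_eq_smul`** — the same on `Θ^B(T)` for every Borel `T ⊆ Ω^B`:
  `(⊗μ)|_{Θ^B T} = σ₀^{|B|} • (Θ^B)_*((Π_b |det jac A_b|) · (⊗η)|_T)`.
* §2 **`lintegral_pi_haar_image_eq`** — `∫_{Θ^B T} F d⊗μ = σ₀^{|B|} ∫_T F(Θ^B A) Π_b|det jac A_b| d⊗η` for EVERY
  `F : (B → G) → ℝ≥0∞` (no measurability: `T.restrict Θ^B` is a measurable embedding).
* §3 **`lintegral_pi_haar_image_image_eq`** — THE SUBSTITUTION INSIDE THE PRODUCT CHART: `ψ : 𝔤^B → 𝔤^B` injective on a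
  Borel `S` with a derivative `ψ′` within `S` and `ψ(S) ⊆ Ω^B`:
  `∫_{Θ^B(ψ S)} F d⊗μ = σ₀^{|B|} ∫_S F(Θ^B(ψ X)) · Π_b |det jac((ψX)_b)| · |det ψ′(X)| d⊗η` — the link between a change of
  variables proved in flat coordinates on `B → 𝔤` and the product Haar measure of the bond variables.
* §4 **`lintegral_pi_haar_image_eq_lintegral_mul_jacobian`** — the `σ₀`-free Haar-to-Haar form on `G^B` for `Ψ : G^B → G^B`
  with `Ψ ∘ Θ^B = Θ^B ∘ ψ` on `S ⊆ B(0,s)^B`: `∫_{Ψ(Θ^B S)} F d⊗μ = ∫_{Θ^B S} F(Ψ U) · J_Ψ(U) d⊗μ`, `J_Ψ` written out.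

HONEST SCOPE.  (i) Standard measure theory; nothing of Bałaban's asserted or estimated; no chart of Bałaban's constructed
(`ψ`, `ψ′`, `S` are the consumer's).  (ii) `σ₀` is p28's window constant, identified not evaluated.  (iii) Nothing of p28 ∕
file 1 ∕ Mathlib re-proved except the three private Fubini helpers.  (iv) Only injectivity domains `Ω` of ONE chart `Θ` and
boxes over them; the `SU(N)` ∕ `U(N)` instances are obtained by the consumer from p28's `isChartRep_specialUnitaryGroup` ∕
`isChartRep_unitaryGroup` (nothing group-specific here).
-/

noncomputable section

open NormedSpace Set Function Filter Topology MeasureTheory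
open scoped ENNReal NNReal

namespace Literature.MathematicalPhysics.QuantumFieldTheory.Balaban1983to89

/-! ## §0 Fubini–Tonelli on finite products (file-private helpers; p28 gen 16's twins are `private`) -/

namespace HaarExpChartChangeOfVariablesPi

variable {ι : Type*} [Fintype ι] {E : Type*} [MeasurableSpace E]

omit [Fintype ι] in
/-- `∫ c · Π_{i∈s} f_i(x_i)`, marginalised over `s`, is the constant `c · Π_{i∈s} ∫ f_i dκ_i` (p28 gen 16's private twin). [folklore] -/
private theorem lmarginal_const_mul_prod' (κ : ι → Measure E) [∀ i, SigmaFinite (κ i)] {f : ι → E → ℝ≥0∞}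
    (hf : ∀ i, Measurable (f i)) [DecidableEq ι] (s : Finset ι) :
    ∀ (c : ℝ≥0∞) (x : ι → E),
      (∫⋯∫⁻_s, (fun y => c * ∏ i ∈ s, f i (y i)) ∂κ) x = c * ∏ i ∈ s, ∫⁻ y, f i y ∂(κ i) := by
  induction s using Finset.induction_on with
  | empty =>
    intro c x
    simp only [lmarginal_empty, Finset.prod_empty, mul_one]
  | @insert i s hi ih =>
    intro c x
    have hmeas : Measurable fun y : ι → E => c * ∏ j ∈ insert i s, f j (y j) :=
      measurable_const.mul (Finset.measurable_prod _ fun j _ => (hf j).comp (measurable_pi_apply j))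
    rw [lmarginal_insert' _ hmeas hi]
    have hfun : (fun y : ι → E => ∫⁻ t, (fun z : ι → E => c * ∏ j ∈ insert i s, f j (z j)) (Function.update y i t) ∂κ i)
        = fun y => (c * ∫⁻ t, f i t ∂κ i) * ∏ j ∈ s, f j (y j) := by
      funext y
      have hpt : ∀ t, c * ∏ j ∈ insert i s, f j (Function.update y i t j) = (c * ∏ j ∈ s, f j (y j)) * f i t := by
        intro t
        rw [Finset.prod_insert hi, Function.update_self,
          Finset.prod_congr rfl (fun j hj => by rw [Function.update_of_ne (ne_of_mem_of_not_mem hj hi)])]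
        ring
      simp only [hpt]
      rw [lintegral_const_mul _ (hf i)]
      ring
    rw [hfun, ih, Finset.prod_insert hi]
    ring

/-- Tonelli on a finite product: `∫ Π_i f_i(x_i) d(⊗_i κ_i) = Π_i ∫ f_i dκ_i` (p28 gen 16's private twin). [folklore] -/
private theorem lintegral_prod_pi' (κ : ι → Measure E) [∀ i, SigmaFinite (κ i)] {f : ι → E → ℝ≥0∞}
    (hf : ∀ i, Measurable (f i)) (x₀ : ι → E) :
    ∫⁻ x, ∏ i, f i (x i) ∂(Measure.pi κ) = ∏ i, ∫⁻ y, f i y ∂(κ i) := by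
  classical
  rw [lintegral_eq_lmarginal_univ x₀]
  have h := lmarginal_const_mul_prod' κ hf Finset.univ 1 x₀
  simp only [one_mul] at h
  exact h

/-- `⊗_i (f_i · κ_i) = (Π_i f_i(x_i)) · ⊗_i κ_i` (p28 gen 16's private twin). [folklore] -/
private theorem pi_withDensity' (κ : ι → Measure E) [∀ i, SigmaFinite (κ i)] {f : ι → E → ℝ≥0∞}
    (hf : ∀ i, Measurable (f i)) [∀ i, SigmaFinite ((κ i).withDensity (f i))] (x₀ : ι → E) :
    Measure.pi (fun i => (κ i).withDensity (f i)) = (Measure.pi κ).withDensity (fun x => ∏ i, f i (x i)) := by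
  refine Measure.pi_eq (μ := fun i => (κ i).withDensity (f i)) fun s hs => ?_
  rw [withDensity_apply _ (MeasurableSet.univ_pi hs), ← lintegral_indicator (MeasurableSet.univ_pi hs)]
  have hind : (Set.pi univ s).indicator (fun x : ι → E => ∏ i, f i (x i)) =
      fun x => ∏ i, (s i).indicator (f i) (x i) := by
    funext x
    by_cases hx : x ∈ Set.pi univ s
    · rw [indicator_of_mem hx]
      exact Finset.prod_congr rfl fun i _ => (indicator_of_mem (hx i (mem_univ i)) _).symm
    · rw [indicator_of_notMem hx]
      simp only [Set.mem_univ_pi, not_forall] at hx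
      obtain ⟨i, hi⟩ := hx
      exact (Finset.prod_eq_zero (Finset.mem_univ i) (indicator_of_notMem hi _)).symm
  rw [hind, lintegral_prod_pi' κ (fun i => (hf i).indicator (hs i)) x₀]
  exact Finset.prod_congr rfl fun i _ => by rw [withDensity_apply _ (hs i), lintegral_indicator (hs i)]

/-- `⊗_i (c_i • κ_i) = (Π_i c_i) • ⊗_i κ_i` (p28 gen 16's private twin). [folklore] -/
private theorem pi_const_smul' (κ : ι → Measure E) [∀ i, SigmaFinite (κ i)] (c : ι → ℝ≥0∞)
    [∀ i, SigmaFinite (c i • κ i)] :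
    Measure.pi (fun i => c i • κ i) = (∏ i, c i) • Measure.pi κ := by
  refine Measure.pi_eq (μ := fun i => c i • κ i) fun s _ => ?_
  rw [Measure.smul_apply, smul_eq_mul, Measure.pi_pi, ← Finset.prod_mul_distrib]
  exact Finset.prod_congr rfl fun i _ => by rw [Measure.smul_apply, smul_eq_mul]

end HaarExpChartChangeOfVariablesPi

namespace HaarExponentialChart

namespace IsChartRep

open B13HaarSigmaJacobian (jac)
open HaarExpChartChangeOfVariablesPi

variable {𝔸 : Type*} [NormedRing 𝔸] [NormedAlgebra ℂ 𝔸] [CompleteSpace 𝔸]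
variable {G : Type*} [Group G] [TopologicalSpace G] [IsTopologicalGroup G] [CompactSpace G]
variable {C : LogChart 𝔸} {ρ : G →* 𝔸} (h : IsChartRep C ρ) [FiniteDimensional ℝ C.lie]
  (hlie : ∀ x ∈ C.lie, ∀ y ∈ C.lie, x * y - y * x ∈ C.lie)
variable [MeasurableSpace C.lie] [BorelSpace C.lie] (η : Measure C.lie) [η.IsAddHaarMeasure]
variable [MeasurableSpace G] [BorelSpace G] (μ : Measure G) [μ.IsHaarMeasure]

/-! ## §1 The product Haar measure on the box `(Θ Ω)^B` and on images `Θ^B(T)`, `T ⊆ Ω^B` -/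

variable (B : Type*) [Fintype B]

omit [CompleteSpace 𝔸] [IsTopologicalGroup G] [CompactSpace G] [FiniteDimensional ℝ C.lie] [MeasurableSpace C.lie]
  [BorelSpace C.lie] [MeasurableSpace G] [BorelSpace G] [Fintype B] in
/-- Bookkeeping: `Θ^B (Ω^B) = (Θ Ω)^B`. [cite: Balaban1985UV3, (18) p. 260 (bookkeeping)] -/
theorem image_piChart_pi (Ω : Set C.lie) :
    (fun (A : B → C.lie) (b : B) => h.expChart (A b)) '' Set.pi Set.univ (fun _ => Ω) =
      Set.pi Set.univ (fun _ : B => h.expChart '' Ω) := by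
  classical
  ext U
  simp only [Set.mem_image, Set.mem_univ_pi]
  constructor
  · rintro ⟨A, hA, rfl⟩ b
    exact ⟨A b, hA b, rfl⟩
  · intro hU
    choose A hA hAU using hU
    exact ⟨A, hA, funext hAU⟩

omit [CompleteSpace 𝔸] [IsTopologicalGroup G] [CompactSpace G] [FiniteDimensional ℝ C.lie] [MeasurableSpace C.lie]
  [BorelSpace C.lie] [MeasurableSpace G] [BorelSpace G] [Fintype B] in
/-- Bookkeeping: `Θ^B` is injective on `Ω^B` when `Θ` is injective on `Ω`. [cite: Balaban1985UV3, (18) p. 260 (bookkeeping)] -/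
theorem injOn_piChart_pi {Ω : Set C.lie} (hinj : Set.InjOn h.expChart Ω) :
    Set.InjOn (fun (A : B → C.lie) (b : B) => h.expChart (A b)) (Set.pi Set.univ (fun _ => Ω)) := by
  intro A hA A' hA' hAA'
  funext b
  exact hinj (hA b (Set.mem_univ b)) (hA' b (Set.mem_univ b)) (congrFun hAA' b)

/-- **[Balaban1985UV3] (18) ON A WINDOW — THE PRODUCT HAAR MEASURE OF THE BOND VARIABLES ON THE BOX `(Θ Ω)^B` IN EXPONENTIAL
COORDINATES: `(⊗_b μ)|_{(Θ Ω)^B} = σ₀^{|B|} • (Θ^B)_*((Π_b |det jac(A_b)|) · (⊗_b η)|_{Ω^B})`** for EVERY Borel `Ω ⊆ 𝔤` on which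
`Θ` is injective (no full-measure hypothesis; p28 gen 13's one-variable `μ|_{Θ Ω} = σ₀ • ν_Ω` tensored `|B|` times).
[cite: Balaban1985UV3, (18) p. 260] [cite: Helgason2000, Ch. I §1 Thm. 1.14 (13) p. 96] -/
theorem pi_haar_restrict_eq_smul {s : ℝ} (hs0 : 0 < s) (hs : s ≤ chartRadius C) {Ω : Set C.lie}
    (hΩ : MeasurableSet Ω) (hinj : Set.InjOn h.expChart Ω) :
    (Measure.pi fun _ : B => μ).restrict (Set.pi Set.univ fun _ => h.expChart '' Ω) =
      (μ (h.window s) / h.chartMeasure hlie η s (h.window s)) ^ Fintype.card B •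
        (((Measure.pi fun _ : B => η).restrict (Set.pi Set.univ fun _ => Ω)).withDensity
            (fun A => ∏ b, jacDensity hlie (A b))).map (fun A b => h.expChart (A b)) := by
  classical
  set c : ℝ≥0∞ := μ (h.window s) / h.chartMeasure hlie η s (h.window s) with hc
  set κ : Measure C.lie := (η.restrict Ω).withDensity (jacDensity hlie) with hκ
  haveI hκσ : SigmaFinite κ :=
    SigmaFinite.withDensity_of_ne_top' fun X => by rw [jacDensity_def]; exact ENNReal.ofReal_ne_top
  have hν : h.chartMeasureOn hlie η Ω = κ.map h.expChart := rfl
  have hcc := h.windowConst_ne_zero_and_ne_top hlie η μ hs0 hs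
  -- `ν_Ω` is finite: `σ₀ · ν_Ω(G) = μ(Θ Ω) < ∞` and `σ₀ ≠ 0`
  have hItop : ∫⁻ X in Ω, jacDensity hlie X ∂η ≠ ∞ := by
    intro htop
    have hid := h.haar_image_eq hlie η μ hs0 hs hΩ hinj
    rw [htop, ENNReal.mul_top hcc.1] at hid
    exact (measure_lt_top μ _).ne hid
  haveI : IsFiniteMeasure (κ.map h.expChart) :=
    ⟨by rw [← hν, h.chartMeasureOn_univ hlie η Ω]; exact hItop.lt_top⟩
  haveI : IsFiniteMeasure (c • κ.map h.expChart) :=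
    ⟨by rw [Measure.smul_apply, smul_eq_mul]; exact ENNReal.mul_lt_top hcc.2.lt_top (measure_lt_top _ _)⟩
  have hμ : μ.restrict (h.expChart '' Ω) = c • κ.map h.expChart :=
    h.haar_restrict_image_eq_smul_chartMeasureOn hlie η μ hs0 hs hΩ hinj
  -- step 1: restriction of the product = product of the restrictions; constants out
  rw [Measure.restrict_pi_pi]
  have h1 : Measure.pi (fun _ : B => μ.restrict (h.expChart '' Ω)) =
      c ^ Fintype.card B • Measure.pi (fun _ : B => κ.map h.expChart) := by
    have hfam : (fun _ : B => μ.restrict (h.expChart '' Ω)) = fun _ : B => c • κ.map h.expChart := funext fun _ => hμ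
    rw [hfam, pi_const_smul' (fun _ : B => κ.map h.expChart) (fun _ => c), Finset.prod_const, Finset.card_univ]
  -- step 2: push-forwards out
  have h2 : Measure.pi (fun _ : B => κ.map h.expChart) =
      (Measure.pi fun _ : B => κ).map (fun A b => h.expChart (A b)) :=
    (Measure.pi_map_pi fun _ => h.measurable_expChart.aemeasurable).symm
  -- step 3: densities and restrictions out
  have h3 : Measure.pi (fun _ : B => κ) =
      ((Measure.pi fun _ : B => η).restrict (Set.pi Set.univ fun _ => Ω)).withDensity
        (fun A => ∏ b, jacDensity hlie (A b)) := by
    rw [hκ, pi_withDensity' (fun _ : B => η.restrict Ω) (fun _ => measurable_jacDensity hlie) (fun _ => (0 : C.lie)),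
      Measure.restrict_pi_pi]
  rw [h1, h2, h3]

/-- **THE SAME ON THE IMAGE OF ANY BOREL `T ⊆ Ω^B`: `(⊗_b μ)|_{Θ^B T} = σ₀^{|B|} • (Θ^B)_*((Π_b |det jac(A_b)|) · (⊗_b η)|_T)`**
(restrict the box identity to `Θ^B T`; `Θ^B` is injective on `Ω^B ⊇ T`, so `Ω^B ∩ (Θ^B)⁻¹(Θ^B T) = T`).
[cite: Balaban1985UV3, (18) p. 260] [cite: Helgason2000, Ch. I §1 Thm. 1.14 (13) p. 96] -/
theorem pi_haar_restrict_image_eq_smul {s : ℝ} (hs0 : 0 < s) (hs : s ≤ chartRadius C) {Ω : Set C.lie}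
    (hΩ : MeasurableSet Ω) (hinj : Set.InjOn h.expChart Ω) {T : Set (B → C.lie)} (hT : MeasurableSet T)
    (hTΩ : T ⊆ Set.pi Set.univ fun _ => Ω) :
    (Measure.pi fun _ : B => μ).restrict ((fun A b => h.expChart (A b)) '' T) =
      (μ (h.window s) / h.chartMeasure hlie η s (h.window s)) ^ Fintype.card B •
        (((Measure.pi fun _ : B => η).restrict T).withDensity
            (fun A => ∏ b, jacDensity hlie (A b))).map (fun A b => h.expChart (A b)) := by
  haveI : T2Space G := h.isClosedEmbedding.isEmbedding.t2Space
  haveI : SecondCountableTopology G := h.secondCountableTopology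
  have hΘB : Measurable (fun (A : B → C.lie) (b : B) => h.expChart (A b)) :=
    measurable_pi_lambda _ fun b => h.measurable_expChart.comp (measurable_pi_apply b)
  have hΘBc : Continuous (fun (A : B → C.lie) (b : B) => h.expChart (A b)) :=
    continuous_pi fun b => h.continuous_expChart.comp (continuous_apply b)
  have hinjB := h.injOn_piChart_pi B hinj
  have hTimg : MeasurableSet ((fun (A : B → C.lie) (b : B) => h.expChart (A b)) '' T) :=
    hT.image_of_continuousOn_injOn hΘBc.continuousOn (hinjB.mono hTΩ)
  have hsub : (fun (A : B → C.lie) (b : B) => h.expChart (A b)) '' T ⊆ Set.pi Set.univ fun _ => h.expChart '' Ω := by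
    rw [← h.image_piChart_pi B Ω]; exact Set.image_mono hTΩ
  have hpre : Set.pi Set.univ (fun _ => Ω) ∩ (fun (A : B → C.lie) (b : B) => h.expChart (A b)) ⁻¹'
      ((fun (A : B → C.lie) (b : B) => h.expChart (A b)) '' T) = T := by
    ext A
    constructor
    · rintro ⟨hA, A', hA', hAA'⟩
      rwa [← hinjB (hTΩ hA') hA hAA']
    · exact fun hA => ⟨hTΩ hA, Set.mem_image_of_mem _ hA⟩
  calc (Measure.pi fun _ : B => μ).restrict ((fun A b => h.expChart (A b)) '' T)
      = ((Measure.pi fun _ : B => μ).restrict (Set.pi Set.univ fun _ => h.expChart '' Ω)).restrict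
          ((fun A b => h.expChart (A b)) '' T) := by
        rw [Measure.restrict_restrict hTimg, Set.inter_eq_left.2 hsub]
    _ = ((μ (h.window s) / h.chartMeasure hlie η s (h.window s)) ^ Fintype.card B •
        (((Measure.pi fun _ : B => η).restrict (Set.pi Set.univ fun _ => Ω)).withDensity
            (fun A => ∏ b, jacDensity hlie (A b))).map (fun A b => h.expChart (A b))).restrict
          ((fun A b => h.expChart (A b)) '' T) := by rw [h.pi_haar_restrict_eq_smul hlie η μ B hs0 hs hΩ hinj]
    _ = (μ (h.window s) / h.chartMeasure hlie η s (h.window s)) ^ Fintype.card B •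
        (((Measure.pi fun _ : B => η).restrict T).withDensity
            (fun A => ∏ b, jacDensity hlie (A b))).map (fun A b => h.expChart (A b)) := by
        rw [Measure.restrict_smul, Measure.restrict_map hΘB hTimg, restrict_withDensity (hΘB hTimg),
          Measure.restrict_restrict (hΘB hTimg), Set.inter_comm, hpre]

/-! ## §2 (18) on `Θ^B(T)` for EVERY integrand -/

/-- **(18) ON THE IMAGE `Θ^B(T)` FOR EVERY INTEGRAND: `∫_{Θ^B T} F d(⊗_b μ) = σ₀^{|B|} · ∫_T F(Θ^B A) · Π_b |det jac(A_b)| d(⊗_b η)`**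
for every `F : (B → G) → ℝ≥0∞`, every Borel injectivity domain `Ω` of `Θ` and every Borel `T ⊆ Ω^B` (no measurability of
`F`: `T.restrict Θ^B` is a measurable embedding). [cite: Balaban1985UV3, (18) p. 260] [cite: Helgason2000, Ch. I §1 Thm. 1.14 (13) p. 96] -/
theorem lintegral_pi_haar_image_eq {s : ℝ} (hs0 : 0 < s) (hs : s ≤ chartRadius C) {Ω : Set C.lie}
    (hΩ : MeasurableSet Ω) (hinj : Set.InjOn h.expChart Ω) {T : Set (B → C.lie)} (hT : MeasurableSet T)
    (hTΩ : T ⊆ Set.pi Set.univ fun _ => Ω) (F : (B → G) → ℝ≥0∞) :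
    ∫⁻ U in (fun A b => h.expChart (A b)) '' T, F U ∂(Measure.pi fun _ : B => μ) =
      (μ (h.window s) / h.chartMeasure hlie η s (h.window s)) ^ Fintype.card B *
        ∫⁻ A in T, F (fun b => h.expChart (A b)) * ∏ b, jacDensity hlie (A b) ∂(Measure.pi fun _ : B => η) := by
  haveI : T2Space G := h.isClosedEmbedding.isEmbedding.t2Space
  haveI : SecondCountableTopology G := h.secondCountableTopology
  have hΘB : Measurable (fun (A : B → C.lie) (b : B) => h.expChart (A b)) :=
    measurable_pi_lambda _ fun b => h.measurable_expChart.comp (measurable_pi_apply b)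
  -- `B → 𝔤` is Polish: `T.restrict Θ^B` is a measurable embedding (Lusin–Souslin)
  have hemb : MeasurableEmbedding (T.restrict fun (A : B → C.lie) (b : B) => h.expChart (A b)) :=
    (continuous_pi fun b => h.continuous_expChart.comp (continuous_apply b)).continuousOn.measurableEmbedding hT
      ((h.injOn_piChart_pi B hinj).mono hTΩ)
  have hdens : Measurable fun A : B → C.lie => ∏ b, jacDensity hlie (A b) :=
    Finset.measurable_prod _ fun b _ => (measurable_jacDensity hlie).comp (measurable_pi_apply b)
  rw [h.pi_haar_restrict_image_eq_smul hlie η μ B hs0 hs hΩ hinj hT hTΩ, lintegral_smul_measure, smul_eq_mul]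
  congr 1
  rw [← restrict_withDensity hT, ← map_comap_subtype_coe hT, Measure.map_map hΘB measurable_subtype_coe]
  have hcomp : (fun (A : B → C.lie) (b : B) => h.expChart (A b)) ∘ ((↑) : T → (B → C.lie)) =
      T.restrict (fun (A : B → C.lie) (b : B) => h.expChart (A b)) := rfl
  rw [hcomp, hemb.lintegral_map]
  have h2 : (fun x : T => F (T.restrict (fun (A : B → C.lie) (b : B) => h.expChart (A b)) x)) =
      fun x : T => (F ∘ fun (A : B → C.lie) (b : B) => h.expChart (A b)) (x : B → C.lie) := rfl
  rw [h2, ← (MeasurableEmbedding.subtype_coe hT).lintegral_map (F ∘ fun (A : B → C.lie) (b : B) => h.expChart (A b)),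
    map_comap_subtype_coe hT,
    setLIntegral_withDensity_eq_setLIntegral_mul_non_measurable _ hdens _ hT
      (Eventually.of_forall fun A => by
        exact ENNReal.prod_lt_top (fun b _ => by rw [jacDensity_def]; exact ENNReal.ofReal_lt_top))]
  exact lintegral_congr fun A => mul_comm _ _

/-! ## §3 The substitution inside the product chart -/

/-- **THE CHANGE OF VARIABLES FOR THE PRODUCT HAAR MEASURE UNDER A MAP THAT IS `C¹` IN THE PRODUCT CHART.**  For
`0 < s ≤ s_C`, a Borel injectivity domain `Ω` of `Θ`, a Borel `S ⊆ 𝔤^B`, `ψ : 𝔤^B → 𝔤^B` injective on `S` with derivative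
`ψ′(X)` within `S` at every `X ∈ S`, and `ψ(S) ⊆ Ω^B`:
`∫_{Θ^B(ψ S)} F d(⊗_b μ) = σ₀^{|B|} · ∫_S F(Θ^B(ψ X)) · Π_b |det jac((ψ X)_b)| · |det ψ′(X)| d(⊗_b η)` for every
`F : (B → G) → ℝ≥0∞` — (18) on the image composed with the `ℝⁿ` change of variables on the finite-dimensional space
`B → 𝔤` (Mathlib).  Print: [Balaban1987RG1] (2.10) p. 267 «∫dB′ σ(B′) … » then «B′ = B − hD̃(B)» over all bonds.
[cite: Balaban1985UV3, (18) p. 260] [cite: Balaban1987RG1, (2.10) p. 267] [cite: Helgason2000, Ch. I §1 Thm. 1.14 (13) p. 96] -/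
theorem lintegral_pi_haar_image_image_eq {s : ℝ} (hs0 : 0 < s) (hs : s ≤ chartRadius C) {Ω : Set C.lie}
    (hΩ : MeasurableSet Ω) (hinj : Set.InjOn h.expChart Ω) {S : Set (B → C.lie)} (hS : MeasurableSet S)
    {ψ : (B → C.lie) → (B → C.lie)} {ψ' : (B → C.lie) → (B → C.lie) →L[ℝ] (B → C.lie)}
    (hψ' : ∀ X ∈ S, HasFDerivWithinAt ψ (ψ' X) S X) (hψ : Set.InjOn ψ S)
    (hψS : Set.MapsTo ψ S (Set.pi Set.univ fun _ => Ω)) (F : (B → G) → ℝ≥0∞) :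
    ∫⁻ U in (fun A b => h.expChart (A b)) '' (ψ '' S), F U ∂(Measure.pi fun _ : B => μ) =
      (μ (h.window s) / h.chartMeasure hlie η s (h.window s)) ^ Fintype.card B *
        ∫⁻ X in S, F (fun b => h.expChart (ψ X b)) * (∏ b, jacDensity hlie (ψ X b)) *
          ENNReal.ofReal |(ψ' X).det| ∂(Measure.pi fun _ : B => η) := by
  have hψS' : MeasurableSet (ψ '' S) := measurable_image_of_fderivWithin hS hψ' hψ
  rw [h.lintegral_pi_haar_image_eq hlie η μ B hs0 hs hΩ hinj hψS' hψS.image_subset F,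
    lintegral_image_eq_lintegral_abs_det_fderiv_mul (Measure.pi fun _ : B => η) hS hψ' hψ]
  congr 1
  exact lintegral_congr fun X => by ring

/-- The same for a ball `Ω = B(0, s)`, `s ≤ s_C`, where injectivity of `Θ` is automatic (`injOn_expChart`).
[cite: Balaban1985UV3, (18) p. 260] [cite: Helgason2000, Ch. I §1 Thm. 1.14 (13) p. 96] -/
theorem lintegral_pi_haar_image_image_eq_ball {s : ℝ} (hs0 : 0 < s) (hs : s ≤ chartRadius C)
    {S : Set (B → C.lie)} (hS : MeasurableSet S)
    {ψ : (B → C.lie) → (B → C.lie)} {ψ' : (B → C.lie) → (B → C.lie) →L[ℝ] (B → C.lie)}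
    (hψ' : ∀ X ∈ S, HasFDerivWithinAt ψ (ψ' X) S X) (hψ : Set.InjOn ψ S)
    (hψS : Set.MapsTo ψ S (Set.pi Set.univ fun _ => Metric.ball (0 : C.lie) s)) (F : (B → G) → ℝ≥0∞) :
    ∫⁻ U in (fun A b => h.expChart (A b)) '' (ψ '' S), F U ∂(Measure.pi fun _ : B => μ) =
      (μ (h.window s) / h.chartMeasure hlie η s (h.window s)) ^ Fintype.card B *
        ∫⁻ X in S, F (fun b => h.expChart (ψ X b)) * (∏ b, jacDensity hlie (ψ X b)) *
          ENNReal.ofReal |(ψ' X).det| ∂(Measure.pi fun _ : B => η) :=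
  h.lintegral_pi_haar_image_image_eq hlie η μ B hs0 hs Metric.isOpen_ball.measurableSet (h.injOn_expChart hs) hS hψ'
    hψ hψS F

/-! ## §4 The group-level Jacobian on `G^B` (Haar to Haar, `σ₀`-free) -/

omit [CompleteSpace 𝔸] [IsTopologicalGroup G] [CompactSpace G] [FiniteDimensional ℝ C.lie] [MeasurableSpace C.lie]
  [BorelSpace C.lie] [MeasurableSpace G] [BorelSpace G] [Fintype B] in
/-- Bookkeeping: a map `Ψ` of `G^B` reading `ψ` in the product chart on `S` sends `Θ^B(S)` onto `Θ^B(ψ S)`.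
[cite: Balaban1985UV3, (18) p. 260 (bookkeeping)] -/
theorem image_image_piChart_of_semiconj {S : Set (B → C.lie)} {ψ : (B → C.lie) → (B → C.lie)} {Ψ : (B → G) → (B → G)}
    (hΨ : ∀ X ∈ S, Ψ (fun b => h.expChart (X b)) = fun b => h.expChart (ψ X b)) :
    Ψ '' ((fun A b => h.expChart (A b)) '' S) = (fun A b => h.expChart (A b)) '' (ψ '' S) := by
  rw [Set.image_image, Set.image_image]; exact Set.image_congr fun X hX => hΨ X hX

/-- **THE GROUP-LEVEL HAAR JACOBIAN ON `G^B`.**  For `0 < s ≤ s_C`, a Borel `S ⊆ B(0,s)^B` on which `det jac(X_b) ≠ 0` for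
every `b`, `ψ : 𝔤^B → 𝔤^B` injective and differentiable within `S` with `ψ(S) ⊆ B(0,s)^B`, and `Ψ : G^B → G^B` with
`Ψ(Θ^B X) = Θ^B(ψ X)` on `S`:  **`∫_{Ψ(Θ^B S)} F d(⊗μ) = ∫_{Θ^B S} F(Ψ U) · J_Ψ(U) d(⊗μ)(U)`** for every `F : (B → G) → ℝ≥0∞`,
with `J_Ψ(U) = (Π_b |det jac((ψ(Λ^B U))_b)|) · |det ψ′(Λ^B U)| / Π_b |det jac(Λ U_b)|`, `Λ^B U = (Λ U_b)_b` — the product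
Haar measure of the bond variables to itself, no window constant, no Lebesgue measure in the statement.
[cite: Balaban1985UV3, (18) p. 260] [cite: Balaban1987RG1, (2.10) p. 267] [cite: Helgason2000, Ch. I §1 Thm. 1.14 (13) p. 96] -/
theorem lintegral_pi_haar_image_eq_lintegral_mul_jacobian {s : ℝ} (hs0 : 0 < s) (hs : s ≤ chartRadius C)
    {S : Set (B → C.lie)} (hS : MeasurableSet S) (hSs : S ⊆ Set.pi Set.univ fun _ => Metric.ball (0 : C.lie) s)
    (hjac : ∀ X ∈ S, ∀ b, LinearMap.det (jac hlie (X b) : C.lie →ₗ[ℝ] C.lie) ≠ 0)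
    {ψ : (B → C.lie) → (B → C.lie)} {ψ' : (B → C.lie) → (B → C.lie) →L[ℝ] (B → C.lie)}
    (hψ' : ∀ X ∈ S, HasFDerivWithinAt ψ (ψ' X) S X) (hψ : Set.InjOn ψ S)
    (hψS : Set.MapsTo ψ S (Set.pi Set.univ fun _ => Metric.ball (0 : C.lie) s)) {Ψ : (B → G) → (B → G)}
    (hΨ : ∀ X ∈ S, Ψ (fun b => h.expChart (X b)) = fun b => h.expChart (ψ X b)) (F : (B → G) → ℝ≥0∞) :
    ∫⁻ U in Ψ '' ((fun A b => h.expChart (A b)) '' S), F U ∂(Measure.pi fun _ : B => μ) =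
      ∫⁻ U in (fun A b => h.expChart (A b)) '' S, F (Ψ U) *
        ((∏ b, jacDensity hlie (ψ (fun b => h.logChart (U b)) b)) *
            ENNReal.ofReal |(ψ' fun b => h.logChart (U b)).det| /
          ∏ b, jacDensity hlie (h.logChart (U b))) ∂(Measure.pi fun _ : B => μ) := by
  -- any additive Haar measure on `𝔤` serves as the (invisible) reference measure
  let η : Measure C.lie := (Module.finBasis ℝ C.lie).addHaar
  have hΩ : MeasurableSet (Metric.ball (0 : C.lie) s) := Metric.isOpen_ball.measurableSet
  rw [h.image_image_piChart_of_semiconj B hΨ,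
    h.lintegral_pi_haar_image_image_eq hlie η μ B hs0 hs hΩ (h.injOn_expChart hs) hS hψ' hψ hψS F,
    h.lintegral_pi_haar_image_eq hlie η μ B hs0 hs hΩ (h.injOn_expChart hs) hS hSs]
  congr 1
  refine setLIntegral_congr_fun hS fun X hX => ?_
  have hlt : ∀ b, ‖X b‖ < chartRadius C := fun b =>
    lt_of_lt_of_le (mem_ball_zero_iff.1 (hSs hX b (Set.mem_univ b))) hs
  have hΛ : (fun b => h.logChart (h.expChart (X b))) = X := funext fun b => h.logChart_expChart (hlt b)
  have hΛ' : ∏ b, jacDensity hlie (h.logChart (h.expChart (X b))) = ∏ b, jacDensity hlie (X b) :=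
    Finset.prod_congr rfl fun b _ => by rw [h.logChart_expChart (hlt b)]
  have hj0 : ∏ b, jacDensity hlie (X b) ≠ 0 := Finset.prod_ne_zero_iff.2 fun b _ => by
    rw [jacDensity_def]
    exact fun h0 => hjac X hX b (abs_eq_zero.1 (ENNReal.ofReal_eq_zero.1 h0 |>.antisymm (abs_nonneg _)))
  have hjtop : ∏ b, jacDensity hlie (X b) ≠ ∞ :=
    ENNReal.prod_ne_top fun b _ => by rw [jacDensity_def]; exact ENNReal.ofReal_ne_top
  have hinv : (∏ b, jacDensity hlie (X b))⁻¹ * ∏ b, jacDensity hlie (X b) = 1 := ENNReal.inv_mul_cancel hj0 hjtop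
  dsimp only
  rw [hΨ X hX, hΛ, hΛ', div_eq_mul_inv]
  set f := F fun b => h.expChart (ψ X b)
  set P := ∏ b, jacDensity hlie (ψ X b)
  set d := ENNReal.ofReal |(ψ' X).det|
  set D := ∏ b, jacDensity hlie (X b)
  symm
  calc f * (P * d * D⁻¹) * D = f * P * d * (D⁻¹ * D) := by ring
    _ = f * P * d := by rw [hinv, mul_one]

end IsChartRep

end HaarExponentialChart

end Literature.MathematicalPhysics.QuantumFieldTheory.Balaban1983to89
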